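import Literature.Computability.AlgebraicComplexity.TauConjectureTwoFacts
import Literature.Computability.AlgebraicComplexity.SharpPBitsPPoly
import Literature.Computability.Complexity.PPolyReductions
import Literature.Computability.Complexity.PPolyComplement
import Literature.Computability.Complexity.StringCopy
import HarnessLib

/-!
# Bürgisser's Theorem 4.1(2) as printed (coefficients definable in `CH/poly`): proofs

Sibling proof file of `TauConjectureProofs.lean` (D-0014) for the named fact
`Literature.Computability.AlgebraicComplexity.Burgisser2009_thm41_2` — Bürgisser, *On defining
integers in the counting hierarchy and proving lower bounds in algebraic complexity*, ECCC
TR06-113, Thm. 4.1(2) (= Comput. Complexity 18 (2009), Thm. 4.1(2); STACS 2007, LNCS 4393,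
Thm. 16(2)): if `τ(Per_n) = n^{O(1)}` then for every coefficient sequence `(b(n,k))_{k ≤ q(n)}`
definable in `CH/poly`, `τ(2^{e(n)} ∑_{k ≤ q(n)} b(n,k) X^k) = (log n)^{O(1)}` for some
polynomially bounded `(e(n))`.

The tree proves the UNIFORM form (`Burgisser2009_thm41_2_uniform`, coefficients definable in
`CH`) in `BurgisserTransferProofs.lean` (`Burgisser2009_thm41_2_uniform_of_steps`). The printed
statement has the NONUNIFORM hypothesis "definable in `CH/poly`"; its proof is the same
(p. 14: "By Lemma 2.12 and Lemma 2.5, `CH/poly ⊆ P/poly`, hence the sign and bit languages of `b`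
are in `P/poly`"), the only additional ingredients being `(P/poly)/poly = P/poly`
(`polyAdvice_subset_PPoly`, Arora–Barak 2009, Thm. 6.18) and the closure of `P/poly` under
intersection, complement and polynomial-time preimages, used to assemble the bit arrays of
`b⁺` and `b⁻` (the printed proof treats `b ≥ 0`; the sign gap is filled as in the uniform proof
by `b = b⁺ - b⁻`). This file proves:

* `inter_mem_polyAdvice`, `inter_mem_PPoly`, `PPoly_closed_fst` — closure of `K/poly` (for `K`
  closed under `FP`-preimages and `∩`) and of `P/poly` under intersection, and of `P/poly` under
  the first projection of the pairing;
* `thm41_2_signPart_PPoly` — the core bound for one nonnegative part whose bit array is read off a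
  `P/poly` language (the `P/poly` form of `thm41_2_signPart`);
* `Burgisser2009_thm41_2_of_steps` — Thm. 4.1(2) AS PRINTED from Lemma 2.12, Lemma 2.5(2),
  Thm. 2.10 and the application of Thm. 2.11;
* `Burgisser2009_thm41_2_of_lemma212` — with Lemma 2.5(2) (`CH_subset_PPoly_of_PP_subset_PPoly_holds`),
  Thm. 2.10 (`Burgisser2009_thm210_holds`) and the Koiran step
  (`Burgisser2009_thm41_koiranStep_holds`) discharged in the tree, Thm. 4.1(2) follows from
  Lemma 2.12 (`PP_subset_PPoly_of_isPBounded_perPoly`) alone, hence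
  (`Burgisser2009_thm41_2_of_valiant`) from Valiant's `#P`-hardness of the `0/1` permanent
  (`Valiant1979_per01Plain_isSharpPHardFun`, via `PermanentBitsPPoly.lean`);
* `Burgisser2009_thm41_2_holds`, `Burgisser2009_thm41_2_uniform_holds` — the DISCHARGES (D-0014):
  Lemma 2.12 is now a theorem of the tree (`PP_subset_PPoly_of_isPBounded_perPoly_holds`,
  `SharpPBitsPPoly.lean`: `#P ⊆ FP/poly` under `τ(PER_n) = n^{O(1)}` through the
  `VNP⁰`-completeness of the permanent, Thm. 2.10, and the transcript arithmetisation of Valiant's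
  criterion), so both forms of Thm. 4.1(2) hold outright;
* `not_isPBounded_constantFreeComplexity_perPoly_of_tauConjecture_of_esymm` — consequently
  Bürgisser's transfer theorem (Thm. 1.1(2)) rests on his Cor. 3.9
  (`Burgisser2009_esymm_chDefinable`) alone.

## References

* P. Bürgisser, ECCC TR06-113 (2006), Lemma 2.5, Lemma 2.12, Thm. 2.10, Thm. 2.11, Def. 3.1,
  Thm. 4.1(2) and its proof (p. 14–15); Comput. Complexity 18 (2009) 81–103; STACS 2007,
  LNCS 4393, 133–144, Thm. 16.
* S. Arora, B. Barak, *Computational Complexity* (2009), Def. 6.16, Thm. 6.18.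
* L. G. Valiant, TCS 8 (1979) 189–201, Thm. 1.
-/

noncomputable section

open MvPolynomial Computability Literature.Computability.Complexity
open Literature.Computability.Complexity.Brick (fstF sndF fstF_boolPair sndF_boolPair fstF_mem_FP sndF_mem_FP)

namespace Literature.Computability.AlgebraicComplexity

/-! ### Closure of advice classes and of `P/poly` under intersection -/

/-- **`K/poly` is closed under intersection** when `K` is closed under `FP`-preimages and under
intersection: pair the two advice strings, `a(n) = ⟨a₁(n), a₂(n)⟩`, and intersect the two witness
languages pulled back along `⟨x, ⟨u, v⟩⟩ ↦ ⟨x, u⟩` and `⟨x, ⟨u, v⟩⟩ ↦ ⟨x, v⟩`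
(Arora–Barak 2009, Def. 6.16). [folklore] -/
theorem inter_mem_polyAdvice {K : Set (Language Bool)}
    (hK : ∀ ⦃L : Language Bool⦄, L ∈ K → ∀ ⦃g : List Bool → List Bool⦄, g ∈ FP →
      (g ⁻¹' L : Language Bool) ∈ K)
    (hKi : ∀ ⦃L₁ L₂ : Language Bool⦄, L₁ ∈ K → L₂ ∈ K → L₁ ⊓ L₂ ∈ K)
    {L₁ L₂ : Language Bool} (h₁ : L₁ ∈ polyAdvice K) (h₂ : L₂ ∈ polyAdvice K) :
    L₁ ⊓ L₂ ∈ polyAdvice K := by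
  obtain ⟨L₁', hL₁', a₁, p₁, hp₁, hLa₁⟩ := h₁
  obtain ⟨L₂', hL₂', a₂, p₂, hp₂, hLa₂⟩ := h₂
  have hg₁ : fanoutFn fstF (fstF ∘ sndF) ∈ FP :=
    fanoutFn_mem_FP fstF_mem_FP (comp_mem_FP fstF_mem_FP sndF_mem_FP)
  have hg₂ : fanoutFn fstF (sndF ∘ sndF) ∈ FP :=
    fanoutFn_mem_FP fstF_mem_FP (comp_mem_FP sndF_mem_FP sndF_mem_FP)
  refine ⟨(fanoutFn fstF (fstF ∘ sndF) ⁻¹' L₁' : Language Bool) ⊓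
      (fanoutFn fstF (sndF ∘ sndF) ⁻¹' L₂' : Language Bool),
    hKi (hK hL₁' hg₁) (hK hL₂' hg₂), fun n => boolPair (a₁ n) (a₂ n), 2 * p₁ + 2 + p₂,
    fun n => ?_, fun x => ?_⟩
  · rw [length_boolPair]
    have h1 := hp₁ n
    have h2 := hp₂ n
    simp only [Polynomial.eval_add, Polynomial.eval_mul, Polynomial.eval_ofNat]
    omega
  · change x ∈ L₁ ∧ x ∈ L₂ ↔
      fanoutFn fstF (fstF ∘ sndF) (boolPair x (boolPair (a₁ x.length) (a₂ x.length))) ∈ L₁' ∧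
        fanoutFn fstF (sndF ∘ sndF) (boolPair x (boolPair (a₁ x.length) (a₂ x.length))) ∈ L₂'
    simp only [fanoutFn_apply, Function.comp_apply, fstF_boolPair, sndF_boolPair]
    rw [hLa₁, hLa₂]

/-- **`P/poly` is closed under intersection** (through `P/poly = P/poly-advice`,
`PPoly_eq_polyAdvice_P_holds`, Arora–Barak 2009, Thm. 6.18, and the closure of `P` under
intersection and `FP`-preimages). [folklore] -/
theorem inter_mem_PPoly {L₁ L₂ : Language Bool} (h₁ : L₁ ∈ PPoly) (h₂ : L₂ ∈ PPoly) :
    L₁ ⊓ L₂ ∈ PPoly := by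
  have h : PPoly = polyAdvice Classes.P := PPoly_eq_polyAdvice_P_holds
  rw [h] at h₁ h₂ ⊢
  exact inter_mem_polyAdvice (fun _ hL _ hg => preimage_mem_P hL hg)
    (fun _ _ ha hb => inter_mem_P ha hb) h₁ h₂

/-- **`P/poly` is closed under the first projection of the pairing**:
`{w | (boolUnpair w).1 ∈ L} ∈ P/poly` for `L ∈ P/poly` (an `FP`-preimage). [folklore] -/
theorem PPoly_closed_fst {L : Language Bool} (hL : L ∈ PPoly) :
    {w | (boolUnpair w).1 ∈ L} ∈ PPoly :=
  preimage_mem_PPoly hL boolUnpairFst_mem_FP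

/-! ### One sign: the bound for a 0/1 bit array decidable in `P/poly` -/

/-- **The core of the proof of Thm. 4.1(2), for one nonnegative part, `P/poly` form.** Under
`τ(Per) = n^{O(1)}`, Thm. 2.10 and the Koiran step: for `p, q` p-bounded with `p(n) ≥ n` and a
bit array `bits(n, k, j)` read off a `P/poly` language `L` on `k ≤ q(n)`
(`encBitQuery n k j true ∈ L ↔ bits`), there are a p-bounded `s` and `c` with
`τ(2^{s(r(n))} · ∑_{k ≤ q n} (∑_{j ≤ p n} bits(n,k,j) 2^j) X^k) ≤ (log₂ n + 2)^c` for all `n`, where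
`r(n) = ⟨ℓ(n), λ(n)⟩` (ECCC TR06-113, proof of Thm. 4.1(2), p. 14–15; this is
`thm41_2_signPart` with the language already in `P/poly`). [cite: Burgisser2006, proof of Thm. 4.1(2)] -/
theorem thm41_2_signPart_PPoly
    (hτ : IsPBounded fun n => constantFreeComplexity (perPoly (Fin n) ℤ))
    (h210 : Burgisser2009_thm210) (hK : Burgisser2009_thm41_koiranStep)
    {p q : ℕ → ℕ} (hp : IsPBounded p) (hq : IsPBounded q) (hpn : ∀ n, n ≤ p n)
    (bits : ℕ → ℕ → ℕ → Bool) {L : Language Bool} (hL : L ∈ PPoly)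
    (hagree : ∀ n k j, k ≤ q n → (encBitQuery n k j true ∈ L ↔ bits n k j = true)) :
    ∃ s : ℕ → ℕ, IsPBounded s ∧ ∃ c : ℕ, ∀ n,
      constantFreeComplexity
          (C ((2 : ℤ) ^ s (Nat.pair (bitLen (p n)) (bitLen (q n)))) *
            ∑ k ∈ Finset.range (q n + 1),
              (∑ j ∈ Finset.range (p n + 1),
                if bits n k j then (C (2 : ℤ) : MvPolynomial (Fin 1) ℤ) ^ j else 0) * X 0 ^ k) ≤
        (Nat.log 2 n + 2) ^ c := by
  -- the Koiran step and Thm. 2.10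
  obtain ⟨G, hGfam, hGid⟩ :=
    hK p q hp hq hpn bits ⟨L, hL, fun n k j hk _ => hagree n k j hk⟩
  obtain ⟨s, hs, d, hd⟩ := h210 hτ _ _ hGfam
  refine ⟨s, hs, ?_⟩
  -- the cost bound, pointwise
  have key : ∀ n,
      constantFreeComplexity
          (C ((2 : ℤ) ^ s (Nat.pair (bitLen (p n)) (bitLen (q n)))) *
            ∑ k ∈ Finset.range (q n + 1),
              (∑ j ∈ Finset.range (p n + 1),
                if bits n k j then (C (2 : ℤ) : MvPolynomial (Fin 1) ℤ) ^ j else 0) * X 0 ^ k) ≤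
        (Nat.pair (bitLen (p n)) (bitLen (q n)) ^ d + d) + (bitLen (p n) ^ 2 + bitLen (q n) ^ 2) := by
    intro n
    set ℓ := bitLen (p n) with hℓ
    set μ := bitLen (q n) with hμ
    -- Thm. 2.10 at the member `r = ⟨ℓ, μ⟩`
    have h1 : constantFreeComplexity (C ((2 : ℤ) ^ s (Nat.pair ℓ μ)) * G ℓ μ) ≤
        Nat.pair ℓ μ ^ d + d := by
      have := hd (Nat.pair ℓ μ)
      dsimp only at this
      rw [Nat.unpair_pair] at this
      exact this
    set r := Nat.pair ℓ μ with hr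
    -- the substitution of p. 15 is free
    have h2 : C ((2 : ℤ) ^ s r) * twoBlockPoly p q bits n =
        aeval (blockSubst p q n) (C ((2 : ℤ) ^ s r) * G ℓ μ) := by
      rw [map_mul, aeval_C, algebraMap_eq, hGid n]
    have h3 : constantFreeComplexity (C ((2 : ℤ) ^ s r) * twoBlockPoly p q bits n) ≤ r ^ d + d := by
      rw [h2]
      refine (constantFreeComplexity_aeval_le _ _).trans ?_
      rw [Finset.sum_eq_zero fun v _ => constantFreeComplexity_blockSubst p q n v, add_zero]
      exact h1
    -- the powers
    set ψ : Fin ℓ ⊕ Fin μ → MvPolynomial (Fin 1) ℤ :=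
      Sum.elim (fun i : Fin ℓ => (C (2 : ℤ) : MvPolynomial (Fin 1) ℤ) ^ 2 ^ (i : ℕ))
        (fun i : Fin μ => (X 0 : MvPolynomial (Fin 1) ℤ) ^ 2 ^ (i : ℕ)) with hψ
    have h4 : C ((2 : ℤ) ^ s r) *
        ∑ k ∈ Finset.range (q n + 1), (∑ j ∈ Finset.range (p n + 1),
          if bits n k j then (C (2 : ℤ) : MvPolynomial (Fin 1) ℤ) ^ j else 0) * X 0 ^ k =
        aeval ψ (C ((2 : ℤ) ^ s r) * twoBlockPoly p q bits n) := by
      rw [map_mul, aeval_C, algebraMap_eq, hψ, aeval_twoBlockPoly_powers]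
    rw [h4]
    refine (constantFreeComplexity_aeval_le _ _).trans ?_
    exact Nat.add_le_add h3 (sum_constantFreeComplexity_powers_le ℓ μ)
  -- everything is polylog
  have hr : ∃ c : ℕ, ∀ n, Nat.pair (bitLen (p n)) (bitLen (q n)) ≤ (Nat.log 2 n + 2) ^ c :=
    polylog_pair_bitLen hp hq
  exact polylog_mono key
    (polylog_add (polylog_add (polylog_pow hr d) (polylog_const d))
      (polylog_add (polylog_pow (polylog_bitLen hp) 2) (polylog_pow (polylog_bitLen hq) 2)))

/-! ### Assembly: Thm. 4.1(2) as printed -/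

/-- **Bürgisser's Theorem 4.1(2), as printed (coefficients definable in `CH/poly`), from
Lemma 2.12, Lemma 2.5(2), Theorem 2.10 and the application of Theorem 2.11** (ECCC TR06-113,
proof of Thm. 4.1(2), p. 14–15: `CH/poly ⊆ P/poly` by Lemma 2.12, Lemma 2.5 and
`(P/poly)/poly = P/poly`; the sign of the coefficients, not treated in the printed proof, is
handled by `b = b⁺ - b⁻`, the two bit arrays being read off `P/poly` languages assembled from
the sign and bit languages of Def. 3.1 by intersection, complement and first projection). [cite: Burgisser2006, Thm. 4.1(2)] -/
theorem Burgisser2009_thm41_2_of_steps (h212 : PP_subset_PPoly_of_isPBounded_perPoly)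
    (h25 : CH_subset_PPoly_of_PP_subset_PPoly) (h210 : Burgisser2009_thm210)
    (hK : Burgisser2009_thm41_koiranStep) : Burgisser2009_thm41_2 := by
  intro hτ q b hb
  obtain ⟨hq, ⟨c, hc⟩, ⟨S, hS, hS'⟩, ⟨B, hB, hB'⟩⟩ := hb
  have hCHP : CH ⊆ PPoly := h25 (h212 hτ)
  -- `CH/poly ⊆ (P/poly)/poly = P/poly`
  have hAdv : polyAdvice CH ⊆ PPoly := polyAdvice_subset_PPoly hCHP
  have hSP : S ∈ PPoly := hAdv hS
  have hBP : B ∈ PPoly := hAdv hB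
  -- the bit bound `p(n) = n^c + n ≥ n`
  have hp : IsPBounded (fun n => n ^ c + n) :=
    IsPBounded.add_holds (IsPBounded.pow_holds IsPBounded.id c) IsPBounded.id
  have hpn : ∀ n, n ≤ n ^ c + n := fun n => Nat.le_add_left _ _
  -- the bit arrays of `b⁺` and `b⁻` and their `P/poly` languages
  have hLp : B ⊓ {x | (boolUnpair x).1 ∈ S} ∈ PPoly := inter_mem_PPoly hBP (PPoly_closed_fst hSP)
  have hLm : B ⊓ {x | (boolUnpair x).1 ∈ Sᶜ} ∈ PPoly :=
    inter_mem_PPoly hBP (PPoly_closed_fst (compl_mem_PPoly hSP))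
  have hfst : ∀ n k j, (boolUnpair (encBitQuery n k j true)).1 = encIdx n k := fun n k j => by
    simp [encBitQuery]
  have hagp : ∀ n k j, k ≤ q n → (encBitQuery n k j true ∈ B ⊓ {x | (boolUnpair x).1 ∈ S} ↔
      (decide (0 ≤ b n k) && (b n k).natAbs.testBit j) = true) := by
    intro n k j hk
    change encBitQuery n k j true ∈ B ∧ (boolUnpair (encBitQuery n k j true)).1 ∈ S ↔ _
    rw [hB' n k j true hk, hfst, hS' n k hk, Bool.and_eq_true, decide_eq_true_iff, and_comm]
  have hagm : ∀ n k j, k ≤ q n → (encBitQuery n k j true ∈ B ⊓ {x | (boolUnpair x).1 ∈ Sᶜ} ↔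
      (decide (b n k < 0) && (b n k).natAbs.testBit j) = true) := by
    intro n k j hk
    change encBitQuery n k j true ∈ B ∧ (boolUnpair (encBitQuery n k j true)).1 ∈ Sᶜ ↔ _
    rw [hB' n k j true hk, hfst]
    change _ ∧ encIdx n k ∉ S ↔ _
    rw [hS' n k hk, Bool.and_eq_true, decide_eq_true_iff, and_comm, not_le]
  obtain ⟨sp, hsp, cp, hcp⟩ := thm41_2_signPart_PPoly hτ h210 hK hp hq hpn _ hLp hagp
  obtain ⟨sm, hsm, cm, hcm⟩ := thm41_2_signPart_PPoly hτ h210 hK hp hq hpn _ hLm hagm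
  -- the exponent `e(n) = s⁺(r(n)) + s⁻(r(n))`
  have hrB := isPBounded_pair_bitLen hp hq
  refine ⟨fun n => sp (Nat.pair (bitLen (n ^ c + n)) (bitLen (q n))) +
      sm (Nat.pair (bitLen (n ^ c + n)) (bitLen (q n))),
    IsPBounded.add_holds (IsPBounded.comp_holds hsp hrB) (IsPBounded.comp_holds hsm hrB), ?_⟩
  -- the bound for `n ≥ 2`
  have key : ∀ n, 2 ≤ n →
      tauPoly (Polynomial.C ((2 : ℤ) ^ (sp (Nat.pair (bitLen (n ^ c + n)) (bitLen (q n))) +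
          sm (Nat.pair (bitLen (n ^ c + n)) (bitLen (q n))))) *
        ∑ k ∈ Finset.range (q n + 1), Polynomial.C (b n k) * Polynomial.X ^ k) ≤
      (3 * (sm (Nat.pair (bitLen (n ^ c + n)) (bitLen (q n))) + 1) + (Nat.log 2 n + 2) ^ cp + 1) +
        (3 * (sp (Nat.pair (bitLen (n ^ c + n)) (bitLen (q n))) + 1) + (Nat.log 2 n + 2) ^ cm + 1) + 2 := by
    intro n hn
    rw [tauPoly_C_mul_sum]
    set r := Nat.pair (bitLen (n ^ c + n)) (bitLen (q n)) with hr
    set Fp : MvPolynomial (Fin 1) ℤ := ∑ k ∈ Finset.range (q n + 1),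
      (∑ j ∈ Finset.range (n ^ c + n + 1),
        if (decide (0 ≤ b n k) && (b n k).natAbs.testBit j) then
          (C (2 : ℤ) : MvPolynomial (Fin 1) ℤ) ^ j else 0) * X 0 ^ k with hFp
    set Fm : MvPolynomial (Fin 1) ℤ := ∑ k ∈ Finset.range (q n + 1),
      (∑ j ∈ Finset.range (n ^ c + n + 1),
        if (decide (b n k < 0) && (b n k).natAbs.testBit j) then
          (C (2 : ℤ) : MvPolynomial (Fin 1) ℤ) ^ j else 0) * X 0 ^ k with hFm
    -- `f_n = f⁺_n - f⁻_n`
    have hbits : ∀ k ∈ Finset.range (q n + 1), (b n k).natAbs < 2 ^ (n ^ c + n + 1) := by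
      intro k hk
      have hk' : k ≤ q n := Nat.lt_succ_iff.1 (Finset.mem_range.1 hk)
      have h1 : |b n k| ≤ 2 ^ (n ^ c) := hc n k hn hk'
      have h2 : ((b n k).natAbs : ℤ) ≤ 2 ^ (n ^ c) := by rwa [Int.natCast_natAbs]
      have h3 : (b n k).natAbs ≤ 2 ^ (n ^ c) := by exact_mod_cast h2
      exact lt_of_le_of_lt h3 (Nat.pow_lt_pow_right (by norm_num) (by omega))
    have hdec : (∑ k ∈ Finset.range (q n + 1), C (b n k) * (X 0 : MvPolynomial (Fin 1) ℤ) ^ k) =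
        Fp - Fm := by
      rw [hFp, hFm, ← Finset.sum_sub_distrib]
      refine Finset.sum_congr rfl fun k hk => ?_
      rw [← sub_mul, sum_bits_posPart (hbits k hk), sum_bits_negPart (hbits k hk), ← map_sub]
      congr 2
      by_cases h0 : 0 ≤ b n k
      · rw [if_pos h0, if_neg (not_lt.2 h0), sub_zero]
      · rw [if_neg h0, if_pos (not_le.1 h0), zero_sub, neg_neg]
    have hsplit : C ((2 : ℤ) ^ (sp r + sm r)) * (Fp - Fm) =
        C ((2 : ℤ) ^ sm r) * (C ((2 : ℤ) ^ sp r) * Fp) - C ((2 : ℤ) ^ sp r) * (C ((2 : ℤ) ^ sm r) * Fm) := by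
      rw [pow_add, C_mul]
      ring
    rw [hdec, hsplit]
    have hp' := hcp n
    have hm' := hcm n
    rw [← hFp] at hp'
    rw [← hFm] at hm'
    calc constantFreeComplexity (C ((2 : ℤ) ^ sm r) * (C ((2 : ℤ) ^ sp r) * Fp) -
          C ((2 : ℤ) ^ sp r) * (C ((2 : ℤ) ^ sm r) * Fm))
        ≤ constantFreeComplexity (C ((2 : ℤ) ^ sm r) * (C ((2 : ℤ) ^ sp r) * Fp)) +
            constantFreeComplexity (C ((2 : ℤ) ^ sp r) * (C ((2 : ℤ) ^ sm r) * Fm)) + 2 :=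
          constantFreeComplexity_sub_le _ _
      _ ≤ (constantFreeComplexity (C ((2 : ℤ) ^ sm r) : MvPolynomial (Fin 1) ℤ) +
            constantFreeComplexity (C ((2 : ℤ) ^ sp r) * Fp) + 1) +
          (constantFreeComplexity (C ((2 : ℤ) ^ sp r) : MvPolynomial (Fin 1) ℤ) +
            constantFreeComplexity (C ((2 : ℤ) ^ sm r) * Fm) + 1) + 2 := by
          gcongr <;> exact constantFreeComplexity_C_mul_le _ _
      _ ≤ (3 * (sm r + 1) + (Nat.log 2 n + 2) ^ cp + 1) +
          (3 * (sp r + 1) + (Nat.log 2 n + 2) ^ cm + 1) + 2 := by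
          gcongr
          · exact constantFreeComplexity_C_two_pow_le' _
          · exact constantFreeComplexity_C_two_pow_le' _
  -- the right-hand side is polylog
  have hr := polylog_pair_bitLen hp hq
  obtain ⟨c₁, hc₁⟩ : ∃ c₁ : ℕ, ∀ n,
      (3 * (sm (Nat.pair (bitLen (n ^ c + n)) (bitLen (q n))) + 1) + (Nat.log 2 n + 2) ^ cp + 1) +
        (3 * (sp (Nat.pair (bitLen (n ^ c + n)) (bitLen (q n))) + 1) + (Nat.log 2 n + 2) ^ cm + 1) + 2 ≤
      (Nat.log 2 n + 2) ^ c₁ :=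
    polylog_add (polylog_add
      (polylog_add (polylog_add (polylog_mul (polylog_const 3) (polylog_add (polylog_comp hsm hr)
        (polylog_const 1))) ⟨cp, fun _ => le_rfl⟩) (polylog_const 1))
      (polylog_add (polylog_add (polylog_mul (polylog_const 3) (polylog_add (polylog_comp hsp hr)
        (polylog_const 1))) ⟨cm, fun _ => le_rfl⟩) (polylog_const 1)))
      (polylog_const 2)
  exact polylog_of_two_le fun n hn => (key n hn).trans (hc₁ n)

/-- **Bürgisser's Theorem 4.1(2) (as printed) from Lemma 2.12 alone**: Lemma 2.5(2)
(`CH_subset_PPoly_of_PP_subset_PPoly_holds`), Thm. 2.10 (`Burgisser2009_thm210_holds`) and the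
application of Thm. 2.11 (`Burgisser2009_thm41_koiranStep_holds`) are discharged in the tree. [cite: Burgisser2006, Thm. 4.1(2)] -/
theorem Burgisser2009_thm41_2_of_lemma212 (h212 : PP_subset_PPoly_of_isPBounded_perPoly) :
    Burgisser2009_thm41_2 :=
  Burgisser2009_thm41_2_of_steps h212 CH_subset_PPoly_of_PP_subset_PPoly_holds
    Burgisser2009_thm210_holds Burgisser2009_thm41_koiranStep_holds

/-- **Bürgisser's Theorem 4.1(2) (as printed) from Valiant's theorem**: with Lemma 2.12 proved
from the `#P`-hardness of the `0/1` permanent (`PP_subset_PPoly_of_isPBounded_perPoly_of_valiant`,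
`PermanentBitsPPoly.lean`), the printed Thm. 4.1(2) rests on the single classical named fact
`Valiant1979_per01Plain_isSharpPHardFun`. [cite: Burgisser2006, Thm. 4.1(2)] -/
theorem Burgisser2009_thm41_2_of_valiant (hV : Valiant1979_per01Plain_isSharpPHardFun) :
    Burgisser2009_thm41_2 :=
  Burgisser2009_thm41_2_of_lemma212 (PP_subset_PPoly_of_isPBounded_perPoly_of_valiant hV)

/-! ### The discharges -/

/-- **Bürgisser's Theorem 4.1(2), as printed — discharged** (ECCC TR06-113, Thm. 4.1(2) = Comput.
Complexity 18 (2009), Thm. 4.1(2) = STACS 2007, Thm. 16(2)): if `τ(Per_n) = n^{O(1)}` then every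
polynomial family `f_n = ∑_{k ≤ q(n)} b(n,k) X^k` with `(b(n,k))` definable in `CH/poly` has
`τ(2^{e(n)} f_n) = (log n)^{O(1)}` for some polynomially bounded `(e(n))`. All four steps of the
printed proof are theorems of the tree: Lemma 2.12 (`PP_subset_PPoly_of_isPBounded_perPoly_holds`,
`SharpPBitsPPoly.lean`), Lemma 2.5(2) (`CH_subset_PPoly_of_PP_subset_PPoly_holds`), Thm. 2.10
(`Burgisser2009_thm210_holds`) and the application of Thm. 2.11
(`Burgisser2009_thm41_koiranStep_holds`). [cite: Burgisser2006, Thm. 4.1(2)] -/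
theorem Burgisser2009_thm41_2_holds : Burgisser2009_thm41_2 :=
  Burgisser2009_thm41_2_of_lemma212 PP_subset_PPoly_of_isPBounded_perPoly_holds

/-- **Bürgisser's Theorem 4.1(2), uniform form — discharged** (the special case `CH ⊆ CH/poly` of
the printed statement, `Burgisser2009_thm41_2_uniform_of_thm41_2`). [cite: Burgisser2006, Thm. 4.1(2)] -/
theorem Burgisser2009_thm41_2_uniform_holds : Burgisser2009_thm41_2_uniform :=
  Burgisser2009_thm41_2_uniform_of_thm41_2 Burgisser2009_thm41_2_holds

/-- **Bürgisser's transfer theorem modulo Cor. 3.9 only**: if the elementary symmetric functions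
`σ_k(1, …, n)` are definable in `CH` (`Burgisser2009_esymm_chDefinable`, Bürgisser's Cor. 3.9,
iterated multiplication in the counting hierarchy), then the Shub–Smale τ-conjecture implies that
`τ(PER_n)` is not polynomially bounded — every other ingredient of the printed proof (Lemma 2.5,
Lemma 2.12, Thm. 2.10, Thm. 2.11, Thm. 4.1(2), the coefficient bookkeeping and the root count)
being a theorem of the tree. [cite: Burgisser2009, Main Thm. 1.2] -/
theorem not_isPBounded_constantFreeComplexity_perPoly_of_tauConjecture_of_esymm
    (h39 : Burgisser2009_esymm_chDefinable) :
    not_isPBounded_constantFreeComplexity_perPoly_of_tauConjecture :=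
  not_isPBounded_constantFreeComplexity_perPoly_of_tauConjecture_of'
    (Burgisser2009_pochhammerWilkinson_coeff_chDefinable_of_esymm h39) Burgisser2009_thm41_2_holds

end Literature.Computability.AlgebraicComplexity
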